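import Mathlib
import HarnessLib
import Summits.MatrixMultiplication.MatrixMultiplication.Theses.BrentRefutationDepth
import Summits.MatrixMultiplication.MatrixMultiplication.Theorems.BrentRefutationDepthRealThreeByThreeTwenty
import Literature.Computability.AlgebraicComplexity.HasNSRefutation
import Literature.Computability.AlgebraicComplexity.StabilizerTensorRank
import Literature.Computability.Complexity.SumOfSquaresRefutation

/-!
# MatrixMultiplication / BrentRefutationDepth — the SOS floor for `RealThreeByThreeTwenty`
(stmt-MatrixMultiplication-5588): no Brent system has a degree-4 Positivstellensatz refutation

The item `RealThreeByThreeTwenty` (`20 ≤ R_ℝ(⟨3,3,3⟩)`) is the route's "first SOS target": it is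
exactly what a static Positivstellensatz refutation of the real Brent system `B_ℝ(3,19)` certifies
(`realThreeByThreeTwenty_of_hasSOSRefutation`, landed). This file proves the SOS analogue of the
route's support item `NoLinearDepthRefutation` (no NS refutation in multiplier degree `≤ 5`):

**No Brent system `B_K(n, r)` with `r ≥ 1`, over any linearly ordered field `K`, has a static SOS
refutation of half-degree `≤ 2`** (`not_hasSOSRefutation_brentSystem_of_le_two`), i.e. none of the
form `Σ_l q_l² + Σ_e g_e B_e = -1` with `deg q_l ≤ 2`, `deg (g_e B_e) ≤ 4` — however infeasible the
system is (even `B_K(n, 1)` for `n ≥ 2`). In particular (`not_hasSOSRefutation_real_brent_three_nineteen`)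
any SOS certificate for `RealThreeByThreeTwenty` has half-degree `≥ 3`: its Gram matrices are indexed
by the monomials of degree `≤ 3` in the `513` unknowns of `B_ℝ(3,19)` — `C(516, 3) = 22 765 060` of
them before symmetry reduction (against `C(515, 2) = 132 355` at the excluded half-degree `2`).

Proof (a genuine measure defeats degree 4). Since `deg B_e = 3` exactly
(`three_le_totalDegree_brentSystem`), `deg (g_e B_e) ≤ 4` forces every multiplier `g_e` to be affine.
Let `E` be the average of evaluation over the `4 n³` points `x_{u,γ}` (`u = (κ,μ,ν)`, signs
`γ = (ε₁, ε₂) ∈ {±1}²`) that put the scaled, signed standard rank-one term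
`(ε₁ n³ e_{κν}) ⊗ (ε₂ e_{κμ}) ⊗ (ε₁ε₂ e_{μν})` in product slot `t₀` and `0` in all other slots. At
`x_{u,γ}` the Brent polynomial `B_e` evaluates to `n³ · (e_{κν} ⊗ e_{κμ} ⊗ e_{μν})_e - ⟨n,n,n⟩_e`,
independently of `γ`; summed over `u` this vanishes (the standard algorithm
`⟨n,n,n⟩ = Σ_u e_{κν} ⊗ e_{κμ} ⊗ e_{μν}`), so `E(B_e) = 0`; and every coordinate of `x_{u,γ}` carries
a non-trivial sign character, so `Σ_γ x_{u,γ} = 0` and `E(X_s B_e) = 0`. Hence `E(g_e B_e) = 0` for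
affine `g_e`, while `E(q_l²) ≥ 0`: applying `E` to the identity gives `0 ≤ -1`.
(At half-degree `3` genuine measures no longer suffice — `E(B_{ijk} B_e) = 0` for all `e` forces the
measure onto real solutions — so `6` is the first degree at which an SOS certificate can exist, matching
the NS floor `D_NS ≥ 6` of `NoLinearDepthRefutation`.)
-/

set_option linter.dupNamespace false

noncomputable section

namespace Summit.MatrixMultiplication.MatrixMultiplication.Theorems

open scoped BigOperators
open MvPolynomial Finset
open Literature.Computability.AlgebraicComplexity Literature.Computability.Complexity
open Summit.MatrixMultiplication.MatrixMultiplication.Theses.BrentRefutationDepth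

/-! ## Generic lemmas: affine multipliers and linear functionals -/

section Generic

variable {σ K : Type*} [Field K]

/-- A finitely supported exponent vector of degree `≤ 1` is `0` or a single variable. [folklore] -/
theorem finsupp_eq_zero_or_single_of_degree_le_one (s : σ →₀ ℕ) (hs : s.degree ≤ 1) :
    s = 0 ∨ ∃ a, s = Finsupp.single a 1 := by
  classical
  by_cases h0 : s = 0
  · exact Or.inl h0
  right
  obtain ⟨a, ha⟩ : ∃ a, s a ≠ 0 := by
    by_contra h
    push Not at h
    exact h0 (Finsupp.ext h)
  have ha1 : s a = 1 := by
    have := Finsupp.le_degree a s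
    omega
  refine ⟨a, ?_⟩
  have hsplit := Finsupp.single_add_erase a s
  have hdeg : (Finsupp.erase a s).degree = 0 := by
    have h := congrArg Finsupp.degree hsplit
    rw [map_add, Finsupp.degree_single, ha1] at h
    omega
  rw [Finsupp.degree_eq_zero_iff] at hdeg
  rw [← hsplit, hdeg, add_zero, ha1]

/-- The exponent vectors in the support of a polynomial of total degree `≤ 1` have degree `≤ 1`.
[folklore] -/
theorem degree_le_one_of_mem_support {p : MvPolynomial σ K} (hp : p.totalDegree ≤ 1)
    {s : σ →₀ ℕ} (hs : s ∈ p.support) : s.degree ≤ 1 := by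
  have h := le_totalDegree hs
  rw [Finsupp.degree_apply]
  exact h.trans hp

/-- **Affine multipliers are killed by a functional killing `f` and all `X_a · f`.** If a
`K`-linear functional `L` on `K[X_σ]` vanishes on `f` and on every `X_a · f`, then it vanishes on
`g · f` for every `g` of total degree `≤ 1`. [folklore] -/
theorem linearMap_mul_eq_zero_of_totalDegree_le_one (L : MvPolynomial σ K →ₗ[K] K)
    (f : MvPolynomial σ K) (h1 : L f = 0) (hX : ∀ a, L (X a * f) = 0)
    {g : MvPolynomial σ K} (hg : g.totalDegree ≤ 1) : L (g * f) = 0 := by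
  classical
  rw [g.as_sum, Finset.sum_mul, map_sum]
  refine Finset.sum_eq_zero fun s hs => ?_
  have hmono : monomial s (coeff s g) = coeff s g • monomial s (1 : K) := by
    rw [smul_monomial, smul_eq_mul, mul_one]
  rw [hmono, smul_mul_assoc, map_smul]
  rcases finsupp_eq_zero_or_single_of_degree_le_one s (degree_le_one_of_mem_support hg hs) with
    h | ⟨a, rfl⟩
  · subst h
    simp [h1]
  · rw [← X_pow_eq_monomial, pow_one, hX]
    simp

/-- Over a field, if `f ≠ 0` has total degree `≥ 3` and `deg (g · f) ≤ 4`, then `deg g ≤ 1`.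
[folklore] -/
theorem totalDegree_le_one_of_mul {f g : MvPolynomial σ K} (hf : f ≠ 0) (h3 : 3 ≤ f.totalDegree)
    (h4 : (g * f).totalDegree ≤ 4) : g.totalDegree ≤ 1 := by
  by_cases hg : g = 0
  · simp [hg]
  · rw [totalDegree_mul_of_isDomain hg hf] at h4
    omega

/-- The sum of the two signs `±1` vanishes. [folklore] -/
theorem sum_bool_cond_sign : (∑ b : Bool, cond b (-1 : K) 1) = 0 := by
  simp

/-- A sign squares to `1`. [folklore] -/
theorem cond_sign_mul_self (b : Bool) : cond b (-1 : K) 1 * cond b (-1 : K) 1 = 1 := by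
  cases b <;> simp

end Generic

/-! ## The Brent polynomials have total degree exactly `3` -/

section Degree

variable (K : Type*) [Field K]

/-- The coefficient of the monomial `a_{t₀,i} b_{t₀,j} c_{t₀,k}` in the Brent polynomial `B_{ijk}`
is `1`. [folklore] -/
theorem coeff_brentSystem_triad {n r : ℕ} (t₀ : Fin r) (i j k : Fin n × Fin n) :
    coeff (Finsupp.single ((0 : Fin 3), t₀, i) 1 + Finsupp.single ((1 : Fin 3), t₀, j) 1 +
        Finsupp.single ((2 : Fin 3), t₀, k) 1) (brentSystem K n r i j k) = 1 := by
  classical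
  set m₀ := Finsupp.single ((0 : Fin 3), t₀, i) 1 + Finsupp.single ((1 : Fin 3), t₀, j) 1 +
        Finsupp.single ((2 : Fin 3), t₀, k) 1 with hm₀
  have hm₀ne : m₀ ≠ 0 := by
    intro h
    have := DFunLike.congr_fun h ((0 : Fin 3), t₀, i)
    simp [m₀] at this
  rw [brentSystem_apply, coeff_sub, coeff_C, if_neg (Ne.symm hm₀ne), sub_zero, coeff_sum]
  have hmono : ∀ t : Fin r, X ((0 : Fin 3), t, i) * X ((1 : Fin 3), t, j) * X ((2 : Fin 3), t, k) =
      monomial (Finsupp.single ((0 : Fin 3), t, i) 1 + Finsupp.single ((1 : Fin 3), t, j) 1 +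
        Finsupp.single ((2 : Fin 3), t, k) 1) (1 : K) := by
    intro t
    simp only [X, monomial_mul, one_mul]
  simp_rw [hmono, coeff_monomial]
  rw [Finset.sum_eq_single t₀]
  · simp [m₀]
  · intro t _ ht
    rw [if_neg]
    intro h
    have := DFunLike.congr_fun h ((0 : Fin 3), t, i)
    simp [m₀, ht] at this
  · simp

/-- For `r ≥ 1` every Brent polynomial `B_{ijk}` is non-zero of total degree `≥ 3` (hence `= 3`,
`totalDegree_brentSystem_le`). [folklore] -/
theorem three_le_totalDegree_brentSystem {n r : ℕ} (t₀ : Fin r) (i j k : Fin n × Fin n) :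
    brentSystem K n r i j k ≠ 0 ∧ 3 ≤ (brentSystem K n r i j k).totalDegree := by
  classical
  set m₀ := Finsupp.single ((0 : Fin 3), t₀, i) 1 + Finsupp.single ((1 : Fin 3), t₀, j) 1 +
        Finsupp.single ((2 : Fin 3), t₀, k) 1 with hm₀
  have hmem : m₀ ∈ (brentSystem K n r i j k).support := by
    rw [mem_support_iff, coeff_brentSystem_triad]
    exact one_ne_zero
  refine ⟨fun h => ?_, ?_⟩
  · rw [h] at hmem
    simp at hmem
  · have hle := le_totalDegree hmem
    have hdeg : (m₀.sum fun _ e => e) = 3 := by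
      change m₀.degree = 3
      simp [m₀, map_add, Finsupp.degree_single]
    omega

/-- The standard algorithm, entrywise: `Σ_{(κ,μ,ν)} [i = (κ,ν)] [j = (κ,μ)] [k = (μ,ν)] = ⟨n,n,n⟩_{ijk}`.
[cite: Blaser2013, §5 (the trivial algorithm)] -/
theorem sum_standard_triad_apply (n : ℕ) (i j k : Fin n × Fin n) :
    (∑ u : Fin n × Fin n × Fin n, (Pi.single (u.1, u.2.2) 1 : Fin n × Fin n → K) i *
        (Pi.single (u.1, u.2.1) 1 : Fin n × Fin n → K) j *
        (Pi.single (u.2.1, u.2.2) 1 : Fin n × Fin n → K) k) = matMulTensor K n n n i j k := by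
  have h := congrFun (congrFun (congrFun (matMulTensor_eq_sum_standard K n) i) j) k
  rw [h, Finset.sum_apply, Finset.sum_apply, Finset.sum_apply]
  simp only [triad_apply]

end Degree

/-! ## The SOS floor -/

section Floor

variable {K : Type*} [Field K] [LinearOrder K] [IsStrictOrderedRing K]

/-- **The SOS floor of Brent systems.** Over a linearly ordered field, no Brent system `B_K(n, r)`
with `r ≥ 1` has a static Positivstellensatz refutation of half-degree `≤ 2` (squares of quadratics,
products `g_e · B_e` of degree `≤ 4`): the uniform measure on the `4 n³` signed, scaled standard
rank-one configurations in one product slot is a degree-`4` pseudo-expectation (module docstring).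
The SOS counterpart of the route's `NoLinearDepthRefutation`. [folklore] -/
theorem not_hasSOSRefutation_brentSystem_of_le_two (n r d : ℕ) (hr : 1 ≤ r) (hd : d ≤ 2) :
    ¬ HasSOSRefutation
      (fun e : (Fin n × Fin n) × (Fin n × Fin n) × (Fin n × Fin n) =>
        brentSystem K n r e.1 e.2.1 e.2.2) d := by
  classical
  intro H
  obtain ⟨m, q, g, hq, hg, hsum⟩ := H.mono hd
  set t₀ : Fin r := ⟨0, hr⟩ with ht₀
  set N : ℕ := Fintype.card (Fin n × Fin n × Fin n) with hN
  -- the test points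
  set pt : (Fin n × Fin n × Fin n) → Bool × Bool → (Fin 3 × Fin r × (Fin n × Fin n) → K) :=
    fun u γ p => if p.2.1 = t₀ then
      (![cond γ.1 (-1 : K) 1 * (N : K) * (Pi.single (u.1, u.2.2) 1 : Fin n × Fin n → K) p.2.2,
         cond γ.2 (-1 : K) 1 * (Pi.single (u.1, u.2.1) 1 : Fin n × Fin n → K) p.2.2,
         cond γ.1 (-1 : K) 1 * cond γ.2 (-1 : K) 1 *
           (Pi.single (u.2.1, u.2.2) 1 : Fin n × Fin n → K) p.2.2]
          : Fin 3 → K) p.1 else 0 with hpt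
  -- values of the Brent polynomials at the test points (independent of the signs)
  have heval : ∀ u γ (i j k : Fin n × Fin n), eval (pt u γ) (brentSystem K n r i j k) =
      (N : K) * ((Pi.single (u.1, u.2.2) 1 : Fin n × Fin n → K) i *
        (Pi.single (u.1, u.2.1) 1 : Fin n × Fin n → K) j *
        (Pi.single (u.2.1, u.2.2) 1 : Fin n × Fin n → K) k) - matMulTensor K n n n i j k := by
    intro u γ i j k
    rw [eval_brentSystem, Finset.sum_apply, Finset.sum_apply, Finset.sum_apply,
      Finset.sum_eq_single t₀]
    · simp only [triad_apply, pt, if_true, Matrix.cons_val_zero, Matrix.cons_val_one,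
        Matrix.cons_val]
      have h1 := cond_sign_mul_self (K := K) γ.1
      have h2 := cond_sign_mul_self (K := K) γ.2
      linear_combination ((Pi.single (u.1, u.2.2) 1 : Fin n × Fin n → K) i *
        (Pi.single (u.1, u.2.1) 1 : Fin n × Fin n → K) j *
        (Pi.single (u.2.1, u.2.2) 1 : Fin n × Fin n → K) k * (N : K)) *
          (cond γ.2 (-1 : K) 1 * cond γ.2 (-1 : K) 1 * h1 + h2)
    · intro t _ ht
      simp [triad_apply, pt, ht]
    · simp
  -- the sum over the signs of every coordinate of the test points vanishes
  have hsign : ∀ u (s : Fin 3 × Fin r × (Fin n × Fin n)), (∑ γ : Bool × Bool, pt u γ s) = 0 := by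
    rintro u ⟨a, t, i⟩
    by_cases ht : t = t₀
    · subst ht
      fin_cases a <;>
        simp only [pt, if_true, Fintype.sum_prod_type, Fintype.sum_bool, Bool.cond_true,
          Bool.cond_false, Fin.zero_eta, Fin.mk_one, Fin.reduceFinMk, Fin.isValue,
          Matrix.cons_val_zero, Matrix.cons_val_one, Matrix.cons_val] <;>
        ring
    · simp [pt, ht]
  -- the pseudo-expectation: sum of evaluations over all test points
  set E : MvPolynomial (Fin 3 × Fin r × (Fin n × Fin n)) K →ₗ[K] K :=
    ∑ u : Fin n × Fin n × Fin n, ∑ γ : Bool × Bool, (aeval (pt u γ)).toLinearMap with hE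
  have hEapply : ∀ p, E p = ∑ u : Fin n × Fin n × Fin n, ∑ γ : Bool × Bool, eval (pt u γ) p := by
    intro p
    simp only [E, LinearMap.sum_apply, AlgHom.toLinearMap_apply]
    rfl
  -- E kills every Brent polynomial …
  have hE1 : ∀ i j k : Fin n × Fin n, E (brentSystem K n r i j k) = 0 := by
    intro i j k
    rw [hEapply]
    simp_rw [heval, Finset.sum_const, Finset.card_univ]
    rw [← Finset.smul_sum, Finset.sum_sub_distrib, ← Finset.mul_sum, sum_standard_triad_apply,
      Finset.sum_const, Finset.card_univ, ← hN]
    simp [nsmul_eq_mul]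
  -- … and every `X_s · B_e`
  have hEX : ∀ (s : Fin 3 × Fin r × (Fin n × Fin n)) (i j k : Fin n × Fin n),
      E (X s * brentSystem K n r i j k) = 0 := by
    intro s i j k
    rw [hEapply]
    simp_rw [map_mul, eval_X, heval]
    refine Finset.sum_eq_zero fun u _ => ?_
    rw [← Finset.sum_mul, hsign, zero_mul]
  -- hence every `g_e · B_e` with `g_e` affine, which the degree bound forces
  have hEg : ∀ e : (Fin n × Fin n) × (Fin n × Fin n) × (Fin n × Fin n),
      E (g e * brentSystem K n r e.1 e.2.1 e.2.2) = 0 := by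
    intro e
    obtain ⟨hne, h3⟩ := three_le_totalDegree_brentSystem K t₀ e.1 e.2.1 e.2.2
    exact linearMap_mul_eq_zero_of_totalDegree_le_one E _ (hE1 _ _ _) (fun s => hEX s _ _ _)
      (totalDegree_le_one_of_mul hne h3 (hg e))
  -- apply E to the certificate
  have hcontra := congrArg E hsum
  rw [map_add, map_sum, map_sum, Finset.sum_eq_zero (fun e _ => hEg e), add_zero] at hcontra
  have hpos : (0 : K) ≤ ∑ l, E (q l * q l) := by
    refine Finset.sum_nonneg fun l _ => ?_
    rw [hEapply]
    exact Finset.sum_nonneg fun u _ => Finset.sum_nonneg fun γ _ => by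
      rw [map_mul]; exact mul_self_nonneg _
  have hneg : E (-1) < 0 := by
    have hn : n ≠ 0 := by
      rintro rfl
      obtain ⟨e, -⟩ := H.no_common_zero 0
      exact e.1.1.elim0
    have h0 : 0 < n := Nat.pos_of_ne_zero hn
    haveI : Nonempty (Fin n × Fin n × Fin n) := ⟨(⟨0, h0⟩, ⟨0, h0⟩, ⟨0, h0⟩)⟩
    rw [map_neg, neg_lt_zero, hEapply]
    simp only [map_one]
    exact Finset.sum_pos (fun u _ => Finset.sum_pos (fun _ _ => one_pos) Finset.univ_nonempty)
      Finset.univ_nonempty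
  rw [hcontra] at hpos
  exact absurd hpos (not_le.mpr hneg)

/-- **The SOS dry run for `RealThreeByThreeTwenty` needs degree `≥ 6`**: the real Brent system
`B_ℝ(3,19)` has no static Positivstellensatz refutation of half-degree `≤ 2`; any certificate fed to
`realThreeByThreeTwenty_of_hasSOSRefutation` has `d ≥ 3`. [folklore] -/
theorem not_hasSOSRefutation_real_brent_three_nineteen (d : ℕ) (hd : d ≤ 2) :
    ¬ HasSOSRefutation
      (fun e : (Fin 3 × Fin 3) × (Fin 3 × Fin 3) × (Fin 3 × Fin 3) =>
        brentSystem ℝ 3 19 e.1 e.2.1 e.2.2) d :=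
  not_hasSOSRefutation_brentSystem_of_le_two (K := ℝ) 3 19 d (by norm_num) hd

/-- Equivalently: every SOS certificate of `B_ℝ(3,19)` (each of which proves `RealThreeByThreeTwenty`)
has half-degree at least `3`. [folklore] -/
theorem three_le_of_hasSOSRefutation_real_brent_three_nineteen {d : ℕ}
    (h : HasSOSRefutation
      (fun e : (Fin 3 × Fin 3) × (Fin 3 × Fin 3) × (Fin 3 × Fin 3) =>
        brentSystem ℝ 3 19 e.1 e.2.1 e.2.2) d) :
    3 ≤ d ∧ RealThreeByThreeTwenty := by
  refine ⟨?_, realThreeByThreeTwenty_of_hasSOSRefutation h⟩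
  by_contra hlt
  exact not_hasSOSRefutation_real_brent_three_nineteen d (by omega) h

end Floor

end Summit.MatrixMultiplication.MatrixMultiplication.Theorems

end
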